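/-
Copyright (c) 2026 the pub-hodgecm-mathlib formalisation cell (harness21).  Prover seat hodgecm-mathlib-LH4-p14 (g3), req620 Track A «(D-RAM) FOUR-FRAME» squad
(unit U3_Laws, κ-STAGE B; brick «κ-BOX-SUM» (κ-B8 ∕ PART 2-κ) dealt by the dealer LH4-plan (g11) WORD #46 (1) ∕ #49 (1); κ owner LH4-p05 (g3); consumers: the (κ-B₀) payer of
F0P3a-p01 (g32) and this seat's (κS-B₀) assembler).  2026-09-04.
-/
import Summits.HodgeConjecture.HodgeConjecture.Theorems.F0P3cDyRamKappaCountBoxSumBlocks   -- FILE 1 (this seat): blocks + re-indexing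
import Summits.HodgeConjecture.HodgeConjecture.Theorems.F0P3cDyRamStableCountSumPlanes      -- ★ B8 adapters (LH4-p14 (g2)): `sum_filter_even_eq_sum_twice'`
import HarnessLib

/-!
# Crux `H413`, line LH4 «(D-RAM) FOUR-FRAME» road — unit U3_Laws (iii), κ-STAGE B, brick «κ-BOX-SUM» (κ-B8 ∕ PART 2-κ), FILE 2∕4 «PLANES»: one plane (foot part + glue window), the diagonal (H window), and the block evaluations times `q − 1`

Cell `hodgecm-mathlib` (D-0151), FLOOR 0, crux item H413 = `stmt-HodgeConjecture-24833`, route of record `HCCMUnconditional`; squad F0∕P3c∕LH4 (req618∕req620); registered stubs served: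
the κ-Stage-B children (κ-B₀) `F0P3cDyRamFourFrameU3.stub_U3_kappaCount_typeZero` and (κS-B₀) `…stub_U3_kappaSignCount_typeZero` of `Cruxes/H413/Lines/F0_P3c_DyRamFourFrame_U3_Laws.lean`
ED. 10 (tree 4815bda2e7c89814), through the payers that feed THIS identity with the ★ κ-sockets.  THEOREMS ONLY (no `def`, no instance, no notation, no `sorry`, default heartbeats);
lane `--supports stmt-HodgeConjecture-24833` (count-neutral).  Precedent and engine: ★ B10 PART 2 «BOX RE-INDEX» `F0P3cDyRamStableCountBoxReindex{,Planes,Types}` (LH4-p14 (g2)) and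
★ B8 `F0P3cDyRamStableCountSum` — the unsigned (MS) analogue `(q−1)·Σ = q^k − 1`.

THE MATHEMATICS (LH4-p05 (g3) PLAN-KMS v1 §4; per-stratum letters: ★ p856661 T-sockets (LH4-p04 (g2)), κG-C2 G-socket (LH4-p09 (g3)), κH-B2 H-socket (LH4-p06∕p08 (g3)); this
seat's numerics `kappa_sum_tv0.v1` f242ecc3 ∕ `kappa_boxsum_leanshape.v1` 40f1a7eb, 1995∕1995 rows).  Fix a slot `i`.  The κ-weighted class count of the type-0 vertex lattices,
written stratum by stratum over the axis box, is a table with SIGN PARAMETERS: on-branch `T_p(s)`: `[i = p][2d ≤ s][2∣s][s ≤ n_p]·ω q^{s∕2}`; glued `G_p(ρ,s)`: TUBE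
`[i = p]·ω q^{2ρ+s∕2−1}((q−1)[2d ≤ s] − [s+2 = 2d])` + GLUE SHELL at the apex foot (`n_legs = m < n_p = m+s`, `m < 2ρ ≤ 2m−d+1`) `ε·q^{2ρ+s∕2−c}`, `c = ⌈(2ρ−m)∕2⌉`, alive iff
`2d ≤ s + 2c` (foot slot) resp. `d ≤ c` (cross slots); core-hanging `H(ρ)` (equilateral key only): `[d ≤ c]·εH·q^{2ρ−c}`; the core and the wild tubes' stable mass are DEAD.
THE IDENTITY: `(q − 1)·Σ_{box} = SIGN·(q^k − q^{k−B})`, `2k + d = Σn + 2`, `2B = n_i + 2(d%2) + 2 − 3d` (`B ≤ 0` ⇒ `0`), `SIGN = εH` (equilateral) ∕ the apex foot's glue entry at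
slot `i`.  MECHANISM: in the slot's own (foot) plane the on-branch block `Σ_{d ≤ j ≤ ⌊n∕2⌋} q^j` is EXTENDED by the deep tubes and EATEN from below by the boundary tubes
(`s + 2 = 2d`), telescoping to `ω·q^{[2⌊m∕2⌋+d, ⌊n∕2⌋+⌊m∕2⌋]}` when the apex excess is `≥ 2d` and to `0` otherwise; the alive glue cells are the consecutive powers above, up to
`q^{k−1}`; the two pieces tile `[k−B, k−1]` with ONE sign because «excess ≥ 2d ⇒ foot glue sign = ω» (the conductor side condition, a hypothesis here, discharged by the assemblers
with ★ `normSign_eq_one_of_fixed_of_v_sub_one_le`).  `2 ≤ d` is NEEDED (at `d = 1` the tame tube survives and the identity is false — 462 numeric counterexamples).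

CONTENTS (FILE 2∕4 «PLANES»: the two-dimensional pieces and their evaluations).
* §Plane `sum_glueDouble` (the glue cells of a plane collapse to the window) · `kappa_plane_sum` (ONE PLANE of the κ-table: foot part + glue window, slot∕bracket generic).
* §Diag `kappa_diag_sum` (the diagonal: the equilateral H window) · `window_mul_eval(')` · `foot_mul_eval` (times `q − 1`) · slot bookkeeping `vec_single_ite` ∕ `vec_bracket_ite`.
HONEST LABEL.  Count-neutral (`--supports stmt-HodgeConjecture-24833`); finite-sum bookkeeping over `ℚ`, nothing printed is asserted, no lattice enters; the κ-Stage-B children (κ-B₀)∕(κS-B₀) of U3 ED. 10 stay PROVER TARGETS until their payers land; `HC_CM` is proved only modulo the 7 printed citations (2 remaining named inputs: hLiu418 = `stmt-HodgeConjecture-24832`, h413 = `stmt-HodgeConjecture-24833`) until rung 0 closes.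

## References
* [Kottwitz1986BaseChangeUnits] R. E. Kottwitz, *Base change for unit elements of Hecke algebras*, Compositio Math. 60 (1986), §1 pp. 240–241 (κ-orbital integrals of units as signed lattice counts by position).
* [Rogawski1990] J. D. Rogawski, *Automorphic Representations of Unitary Groups in Three Variables*, Ann. of Math. Stud. 123 (1990), §4.9 Prop. 4.9.1 (a) p. 55, §4.10 p. 58 (the κ-signs on the classes inside a stable class).
-/

set_option autoImplicit false

namespace Summit.HodgeConjecture.HodgeConjecture.Cruxes.H413.F0P3cDyRamKappaCountBoxSumPlanes

open Finset
open Summit.HodgeConjecture.HodgeConjecture.Cruxes.H413.F0P3cDyRamKappaCountBoxSumBlocks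

section Plane

variable {R : Type*} [CommRing R]

/-- **THE GLUE DOUBLE SUM of one plane**: the glue cells `(r, t) = (r, r + (n − n'))`, `r` even in the glue window, bracket `brk`, collapse to the window sum
`ε·Σ_{1 ≤ c ≤ (n'−d)/2 + d%2} [brk (n−n') c]·x^{2⌊n'/2⌋ + (n−n')/2 + c}` (and vanish unless `n' = n'' < n`). [folklore] -/
theorem sum_glueDouble (x ε : R) (brk : ℕ → ℕ → Prop) [DecidableRel brk] {d n n' n'' B : ℕ} (hd : 1 ≤ d) (hdn' : d ≤ n')
    (hpar : (n - n') % 2 = 0 → n' % 2 = d % 2) (hB : n + n' ≤ B) :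
    ∑ r ∈ range (B + 1), ∑ t ∈ range (B + 1),
        (if 1 ≤ r ∧ r < t ∧ 2 ∣ r ∧ 2 ∣ (t - r) ∧ n' = n'' ∧ n = n' + (t - r) ∧ n' < r ∧ r - n' ≤ n' - d + 1 ∧ brk (t - r) ((r - n' + 1) / 2)
          then ε * x ^ (r + (t - r) / 2 - (r - n' + 1) / 2) else 0)
      = if n' = n'' ∧ n' < n ∧ (n - n') % 2 = 0 then
          ε * ∑ c ∈ Icc 1 ((n' - d) / 2 + d % 2), (if brk (n - n') c then x ^ (2 * (n' / 2) + (n - n') / 2 + c) else 0)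
        else 0 := by
  by_cases hc : n' = n'' ∧ n' < n ∧ (n - n') % 2 = 0
  · obtain ⟨hc1, hc2, hc3⟩ := hc
    rw [if_pos ⟨hc1, hc2, hc3⟩]
    -- collapse the inner sum at `t = r + (n − n')`
    have hrow : ∀ r ∈ range (B + 1), ∑ t ∈ range (B + 1),
        (if 1 ≤ r ∧ r < t ∧ 2 ∣ r ∧ 2 ∣ (t - r) ∧ n' = n'' ∧ n = n' + (t - r) ∧ n' < r ∧ r - n' ≤ n' - d + 1 ∧ brk (t - r) ((r - n' + 1) / 2)
          then ε * x ^ (r + (t - r) / 2 - (r - n' + 1) / 2) else 0)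
        = if 2 ∣ r ∧ n' < r ∧ r - n' ≤ n' - d + 1 then (if brk (n - n') ((r - n' + 1) / 2) then ε * x ^ ((r - (r - n' + 1) / 2) + (n - n') / 2) else 0) else 0 := by
      intro r hr
      simp only [Finset.mem_range] at hr
      rw [Finset.sum_eq_single (r + (n - n'))]
      · simp only [Nat.add_sub_cancel_left]
        by_cases hw : 2 ∣ r ∧ n' < r ∧ r - n' ≤ n' - d + 1
        · rw [if_pos hw]
          by_cases hb : brk (n - n') ((r - n' + 1) / 2)
          · rw [if_pos hb, if_pos ⟨by omega, by omega, hw.1, by omega, hc1, by omega, hw.2.1, hw.2.2, hb⟩]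
            congr 2
            exact Nat.sub_add_comm (by omega)
          · rw [if_neg hb, if_neg (fun h => hb h.2.2.2.2.2.2.2.2)]
        · rw [if_neg hw, if_neg]
          rintro ⟨-, -, h3, -, -, -, h7, h8, -⟩
          exact hw ⟨h3, h7, h8⟩
      · intro t _ ht
        refine if_neg fun h => ht ?_
        obtain ⟨-, h2, -, -, -, h6, -, -, -⟩ := h
        omega
      · intro ht
        simp only [Finset.mem_range] at ht
        refine if_neg fun h => ht ?_
        obtain ⟨-, h2, -, -, -, h6, h7, h8, -⟩ := h
        omega
    rw [Finset.sum_congr rfl hrow]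
    rw [sum_glueWindow_reindex (fun c e => if brk (n - n') c then ε * x ^ (e + (n - n') / 2) else 0) (hpar hc3) hdn' (by omega)]
    rw [Finset.mul_sum]
    refine Finset.sum_congr rfl fun c _ => ?_
    by_cases hb : brk (n - n') c
    · rw [if_pos hb, if_pos hb]; congr 1; ring
    · rw [if_neg hb, if_neg hb, mul_zero]
  · rw [if_neg hc]
    refine Finset.sum_eq_zero fun r _ => Finset.sum_eq_zero fun t _ => if_neg ?_
    rintro ⟨h1, h2, h3, h4, h5, h6, h7, -, -⟩
    refine hc ⟨h5, by omega, ?_⟩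
    have : t - r = n - n' := by omega
    rw [← this]; exact Nat.mod_eq_zero_of_dvd h4

/-- **ONE PLANE OF THE κ-TABLE** (slot fixed; `tube` = «this plane is the slot's own foot», `brk` = the glue bracket): the triangular sum `Σ_{r<t≤B} φ r t` of a row function following
the κ-table — on-branch row `r = 0`, tube + glue rows `r = 2ρ`, zero odd rows — is the FOOT part `ω·(Σ_{d≤j≤⌊n/2⌋} x^j + Σ_{ρ ≤ ⌊min(n',n'')/2⌋} inner ρ)` (present iff `tube`) plus
the GLUE WINDOW `ε·Σ_c [brk]·x^{2⌊n'/2⌋+(n−n')/2+c}` (present iff `n' = n'' < n`). [folklore] -/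
theorem kappa_plane_sum (x ω ε : R) (tube : Prop) [Decidable tube] (brk : ℕ → ℕ → Prop) [DecidableRel brk] {d n n' n'' B : ℕ} (hd : 2 ≤ d)
    (hdn' : d ≤ n') (hpar : (n - n') % 2 = 0 → n' % 2 = d % 2) (hB : n + n' ≤ B) (φ : ℕ → ℕ → R)
    (hT : ∀ s, 1 ≤ s → φ 0 s = if tube ∧ 2 * d ≤ s ∧ 2 ∣ s ∧ s ≤ n then ω * x ^ (s / 2) else 0)
    (hG : ∀ ρ s, 1 ≤ ρ → 1 ≤ s → φ (2 * ρ) (2 * ρ + s) =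
      (if tube ∧ 2 ∣ s ∧ 2 * ρ ≤ min n' n'' ∧ 2 * ρ + s ≤ n then
          ω * x ^ (2 * ρ + s / 2 - 1) * ((if 2 * d ≤ s then x - 1 else 0) - (if s + 2 = 2 * d then 1 else 0)) else 0) +
      (if 2 ∣ s ∧ n' = n'' ∧ n = n' + s ∧ n' < 2 * ρ ∧ 2 * ρ - n' ≤ n' - d + 1
        then (if brk s ((2 * ρ - n' + 1) / 2) then ε else 0) * x ^ (2 * ρ + s / 2 - (2 * ρ - n' + 1) / 2) else 0))
    (hZ : ∀ r s, 1 ≤ r → ¬ 2 ∣ r → 1 ≤ s → φ r (r + s) = 0) :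
    ∑ r ∈ range (B + 1), ∑ t ∈ range (B + 1), (if r < t then φ r t else 0) =
      (if tube then ω * (∑ j ∈ Icc d (n / 2), x ^ j
          + ∑ ρ ∈ Icc 1 (min n' n'' / 2), ((if ρ + d ≤ n / 2 then x ^ (n / 2 + ρ) - x ^ (2 * ρ + d - 1) else 0) - (if ρ + d ≤ n / 2 + 1 then x ^ (2 * ρ + d - 2) else 0)))
        else 0)
      + (if n' = n'' ∧ n' < n ∧ (n - n') % 2 = 0 then
          ε * ∑ c ∈ Icc 1 ((n' - d) / 2 + d % 2), (if brk (n - n') c then x ^ (2 * (n' / 2) + (n - n') / 2 + c) else 0)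
        else 0) := by
  have hnB : n ≤ B := by omega
  have hmnB : min n' n'' ≤ B := le_trans (min_le_left _ _) (by omega)
  -- the three indicator pieces (kept FOLDED as `fA fB fC` so that every `if_pos`∕`if_neg` below has a unique target)
  obtain ⟨fA, hfA⟩ : ∃ f : ℕ → ℕ → R, ∀ r t, f r t = (if r = 0 ∧ (tube ∧ 2 * d ≤ t ∧ 2 ∣ t ∧ t ≤ n) then ω * x ^ (t / 2) else 0) :=
    ⟨_, fun _ _ => rfl⟩
  obtain ⟨fB, hfB⟩ : ∃ f : ℕ → ℕ → R, ∀ r t, f r t =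
      (if (1 ≤ r ∧ 2 ∣ r ∧ r ≤ min n' n'') ∧ (tube ∧ 2 * (r / 2) < t ∧ 2 ∣ (t - 2 * (r / 2)) ∧ t ≤ n) then
          ω * x ^ (2 * (r / 2) + (t - 2 * (r / 2)) / 2 - 1) * ((if 2 * d ≤ t - 2 * (r / 2) then x - 1 else 0) - (if t - 2 * (r / 2) + 2 = 2 * d then 1 else 0)) else 0) :=
    ⟨_, fun _ _ => rfl⟩
  obtain ⟨fC, hfC⟩ : ∃ f : ℕ → ℕ → R, ∀ r t, f r t =
      (if 1 ≤ r ∧ r < t ∧ 2 ∣ r ∧ 2 ∣ (t - r) ∧ n' = n'' ∧ n = n' + (t - r) ∧ n' < r ∧ r - n' ≤ n' - d + 1 ∧ brk (t - r) ((r - n' + 1) / 2)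
          then ε * x ^ (r + (t - r) / 2 - (r - n' + 1) / 2) else 0) :=
    ⟨_, fun _ _ => rfl⟩
  have hexp : ∀ r t : ℕ, (if r < t then φ r t else 0) = fA r t + fB r t + fC r t := by
    intro r t
    rcases Nat.lt_or_ge r t with hrt | hrt
    · rw [if_pos hrt]
      obtain ⟨s, hs1, rfl⟩ : ∃ s, 1 ≤ s ∧ t = r + s := ⟨t - r, by omega, by omega⟩
      rcases Nat.eq_zero_or_pos r with rfl | hrpos
      · rw [hfB, if_neg (by rintro ⟨⟨h1, -, -⟩, -⟩; omega), hfC, if_neg (by rintro ⟨h1, -⟩; omega), add_zero, add_zero, hfA,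
          Nat.zero_add, hT s hs1]
        by_cases h : tube ∧ 2 * d ≤ s ∧ 2 ∣ s ∧ s ≤ n
        · rw [if_pos h, if_pos ⟨rfl, h⟩]
        · rw [if_neg h, if_neg (fun h' => h h'.2)]
      · by_cases hr2 : 2 ∣ r
        · obtain ⟨ρ, rfl⟩ : ∃ ρ, r = 2 * ρ := ⟨r / 2, by omega⟩
          have hρ : 1 ≤ ρ := by omega
          have eρ : 2 * ρ / 2 = ρ := by omega
          rw [hfA, if_neg (by rintro ⟨h1, -⟩; omega), zero_add, hG ρ s hρ hs1]
          congr 1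
          · rw [hfB]
            simp only [eρ, Nat.add_sub_cancel_left]
            by_cases htb : tube
            · simp only [htb, true_and]
              split_ifs <;> first | rfl | ring1 | (exfalso; omega)
            · simp only [htb, false_and, and_false, if_false]
          · rw [hfC]
            simp only [Nat.add_sub_cancel_left]
            by_cases hb : brk s ((2 * ρ - n' + 1) / 2) <;> simp only [hb, and_true, and_false, if_true, if_false, zero_mul] <;>
              split_ifs <;> first | rfl | ring1 | (exfalso; omega)
        · rw [hZ r s hrpos hr2 hs1, hfA, if_neg (by rintro ⟨h1, -⟩; omega), hfB, if_neg (by rintro ⟨⟨-, h2, -⟩, -⟩; exact hr2 h2), hfC,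
            if_neg (by rintro ⟨-, -, h3, -⟩; exact hr2 h3)]
          ring
    · rw [if_neg (by omega), hfA, if_neg (by rintro ⟨h1, -, h3, -⟩; omega), hfB, if_neg (by rintro ⟨⟨-, h2, -⟩, -, h4, -⟩; omega), hfC,
        if_neg (by rintro ⟨-, h2, -⟩; omega)]
      ring
  simp only [hexp, Finset.sum_add_distrib]
  congr 1
  · -- the foot part: on-branch row + tube rows
    by_cases htb : tube
    · rw [if_pos htb]
      -- on-branch: only `r = 0`
      have hA : ∑ r ∈ range (B + 1), ∑ t ∈ range (B + 1), fA r t = ω * ∑ j ∈ Icc d (n / 2), x ^ j := by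
        simp only [hfA]
        rw [Finset.sum_eq_single_of_mem 0 (by simp) (fun r _ hr => Finset.sum_eq_zero fun t _ => if_neg (fun h => hr h.1))]
        rw [← sum_onBranch_kappa x ω hnB]
        refine Finset.sum_congr rfl fun t _ => ?_
        by_cases h : 2 * d ≤ t ∧ 2 ∣ t ∧ t ≤ n
        · rw [if_pos h, if_pos ⟨rfl, htb, h⟩]
        · rw [if_neg h, if_neg (fun h' => h h'.2.2)]
      -- tubes: rows `r = 2ρ`, `1 ≤ ρ ≤ ⌊min(n',n'')/2⌋`
      have hBt : ∑ r ∈ range (B + 1), ∑ t ∈ range (B + 1), fB r t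
          = ω * ∑ ρ ∈ Icc 1 (min n' n'' / 2), ((if ρ + d ≤ n / 2 then x ^ (n / 2 + ρ) - x ^ (2 * ρ + d - 1) else 0) - (if ρ + d ≤ n / 2 + 1 then x ^ (2 * ρ + d - 2) else 0)) := by
        simp only [hfB]
        -- restrict the outer sum to the even `r` in `[1, min n' n'']`
        have hsub : (Icc 1 (min n' n'')).filter (fun r => r % 2 = 0) ⊆ range (B + 1) := by
          intro r hr
          simp only [Finset.mem_filter, Finset.mem_Icc] at hr
          simp only [Finset.mem_range]; omega
        rw [← Finset.sum_subset hsub]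
        · rw [F0P3cDyRamStableCountSumPlanes.sum_filter_even_eq_sum_twice', Finset.mul_sum]
          have e1 : (1 + 1) / 2 = 1 := rfl
          rw [e1]
          refine Finset.sum_congr rfl fun ρ hρ => ?_
          simp only [Finset.mem_Icc] at hρ
          have eρ : 2 * ρ / 2 = ρ := by omega
          simp only [eρ]
          rw [← sum_tubeRow_kappa x ω hd hnB ρ hρ.1]
          refine Finset.sum_congr rfl fun t _ => ?_
          by_cases h : 2 * ρ < t ∧ 2 ∣ (t - 2 * ρ) ∧ t ≤ n
          · rw [if_pos h, if_pos ⟨⟨by omega, by omega, by omega⟩, htb, h⟩]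
          · rw [if_neg h, if_neg (fun h' => h h'.2.2)]
        · intro r hr hrn
          simp only [Finset.mem_filter, Finset.mem_Icc, not_and] at hrn
          refine Finset.sum_eq_zero fun t _ => if_neg ?_
          rintro ⟨⟨h1, h2, h3⟩, -⟩
          exact hrn ⟨h1, h3⟩ (Nat.mod_eq_zero_of_dvd h2)
      rw [hA, hBt, mul_add]
    · rw [if_neg htb]
      have h1 : ∑ r ∈ range (B + 1), ∑ t ∈ range (B + 1), fA r t = 0 :=
        Finset.sum_eq_zero fun r _ => Finset.sum_eq_zero fun t _ => by rw [hfA]; exact if_neg (fun h => htb h.2.1)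
      have h2 : ∑ r ∈ range (B + 1), ∑ t ∈ range (B + 1), fB r t = 0 :=
        Finset.sum_eq_zero fun r _ => Finset.sum_eq_zero fun t _ => by rw [hfB]; exact if_neg (fun h => htb h.2.1)
      rw [h1, h2, add_zero]
  · simp only [hfC]
    exact sum_glueDouble x ε brk (by omega) hdn' hpar hB

end Plane

section Diag

variable {R : Type*} [CommRing R]

/-- **THE DIAGONAL OF THE κ-TABLE**: `ψ 0 = 0` (dead core), odd `r` zero, `ψ(2ρ)` = the equilateral H-glue cell with bracket `d ≤ ⌈(2ρ−m)/2⌉`; the diagonal sum is the H window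
`εH·Σ_{1 ≤ c ≤ (m−d)/2 + d%2} [d ≤ c]·x^{2⌊m/2⌋ + c}` (present iff the key is equilateral). [folklore] -/
theorem kappa_diag_sum (x εH : R) (e1 e2 : Prop) [Decidable e1] [Decidable e2] {d m B : ℕ} (hdm : d ≤ m) (hpar : m % 2 = d % 2) (hB : e1 → e2 → 2 * m ≤ B)
    (ψ : ℕ → R) (h0 : ψ 0 = 0)
    (hH : ∀ ρ, 1 ≤ ρ → ψ (2 * ρ) = if e1 ∧ e2 ∧ m < 2 * ρ ∧ 2 * ρ - m ≤ m - d + 1 ∧ d ≤ (2 * ρ - m + 1) / 2 then εH * x ^ (2 * ρ - (2 * ρ - m + 1) / 2) else 0)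
    (hZ : ∀ r, 1 ≤ r → ¬ 2 ∣ r → ψ r = 0) :
    ∑ r ∈ range (B + 1), ψ r = if e1 ∧ e2 then εH * ∑ c ∈ Icc 1 ((m - d) / 2 + d % 2), (if d ≤ c then x ^ (2 * (m / 2) + c) else 0) else 0 := by
  by_cases he : e1 ∧ e2
  · rw [if_pos he]
    have hpt : ∀ r, ψ r = if 2 ∣ r ∧ m < r ∧ r - m ≤ m - d + 1 then (if d ≤ (r - m + 1) / 2 then εH * x ^ (r - (r - m + 1) / 2) else 0) else 0 := by
      intro r
      rcases Nat.eq_zero_or_pos r with rfl | hr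
      · rw [h0, if_neg (fun h => by omega)]
      · by_cases hr2 : 2 ∣ r
        · obtain ⟨ρ, rfl⟩ : ∃ ρ, r = 2 * ρ := ⟨r / 2, by omega⟩
          rw [hH ρ (by omega)]
          simp only [he.1, he.2, true_and]
          split_ifs <;> first | rfl | (exfalso; omega)
        · rw [hZ r hr hr2, if_neg (fun h => hr2 h.1)]
    simp only [hpt]
    rw [sum_glueWindow_reindex (fun c e => if d ≤ c then εH * x ^ e else 0) hpar hdm (hB he.1 he.2), Finset.mul_sum]
    refine Finset.sum_congr rfl fun c _ => ?_
    by_cases hb : d ≤ c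
    · rw [if_pos hb, if_pos hb]
    · rw [if_neg hb, if_neg hb, mul_zero]
  · rw [if_neg he]
    refine Finset.sum_eq_zero fun r _ => ?_
    rcases Nat.eq_zero_or_pos r with rfl | hr
    · exact h0
    · by_cases hr2 : 2 ∣ r
      · obtain ⟨ρ, rfl⟩ : ∃ ρ, r = 2 * ρ := ⟨r / 2, by omega⟩
        rw [hH ρ (by omega), if_neg (fun h => he ⟨h.1, h.2.1⟩)]
      · exact hZ r hr hr2

/-- **EVALUATION OF A WINDOW**: `(x − 1)·Σ_{1 ≤ c ≤ C} [L ≤ c]·x^{A+c} = [max 1 L ≤ C]·(x^{A+C+1} − x^{A + max 1 L})`. [folklore] -/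
theorem window_mul_eval (x : R) (A L C : ℕ) :
    (x - 1) * ∑ c ∈ Icc 1 C, (if L ≤ c then x ^ (A + c) else 0) = if max 1 L ≤ C then x ^ (A + C + 1) - x ^ (A + max 1 L) else 0 := by
  have hset : ∑ c ∈ Icc 1 C, (if L ≤ c then x ^ (A + c) else 0) = ∑ c ∈ Icc (max 1 L) C, x ^ (A + c) := by
    rw [← Finset.sum_filter]
    refine Finset.sum_congr ?_ fun _ _ => rfl
    ext c
    simp only [Finset.mem_filter, Finset.mem_Icc, max_le_iff]
    tauto
  rw [hset]
  by_cases h : max 1 L ≤ C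
  · rw [if_pos h]
    have hre : ∑ c ∈ Icc (max 1 L) C, x ^ (A + c) = ∑ j ∈ Icc (A + max 1 L) (A + C), x ^ j := by
      refine Finset.sum_nbij' (fun c => A + c) (fun j => j - A) ?_ ?_ ?_ ?_ ?_
      · intro c hc; simp only [Finset.mem_Icc] at hc ⊢; omega
      · intro j hj; simp only [Finset.mem_Icc] at hj ⊢; omega
      · intro c _; omega
      · intro j hj; simp only [Finset.mem_Icc] at hj; omega
      · intro c _; rfl
    rw [hre, geom_Icc_mul x (by omega)]
  · rw [if_neg h, Finset.Icc_eq_empty_of_lt (by omega), Finset.sum_empty, mul_zero]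

/-- `window_mul_eval` for a bracket predicate `P` equivalent to `L ≤ ·`. [folklore] -/
theorem window_mul_eval' (x : R) (A L C : ℕ) (P : ℕ → Prop) [DecidablePred P] (hP : ∀ c, P c ↔ L ≤ c) :
    (x - 1) * ∑ c ∈ Icc 1 C, (if P c then x ^ (A + c) else 0) = if max 1 L ≤ C then x ^ (A + C + 1) - x ^ (A + max 1 L) else 0 := by
  rw [← window_mul_eval x A L C]
  congr 1
  refine Finset.sum_congr rfl fun c _ => ?_
  simp only [hP c]

/-- **EVALUATION OF THE FOOT** (on-branch block + tubes, times `x − 1`): `[R + d ≤ N]·ω·(x^{N+R+1} − x^{2R+d})`. [folklore] -/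
theorem foot_mul_eval (x ω : R) {d : ℕ} (hd : 1 ≤ d) (N Rr : ℕ) :
    (x - 1) * (ω * (∑ j ∈ Icc d N, x ^ j
        + ∑ ρ ∈ Icc 1 Rr, ((if ρ + d ≤ N then x ^ (N + ρ) - x ^ (2 * ρ + d - 1) else 0) - (if ρ + d ≤ N + 1 then x ^ (2 * ρ + d - 2) else 0))))
      = if Rr + d ≤ N then ω * (x ^ (N + Rr + 1) - x ^ (2 * Rr + d)) else 0 := by
  rw [kappaFootTelescope x hd N Rr]
  by_cases h : Rr + d ≤ N
  · rw [if_pos h, if_pos h]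
    have := geom_Icc_mul x (a := 2 * Rr + d) (b := N + Rr) (by omega)
    calc (x - 1) * (ω * ∑ j ∈ Icc (2 * Rr + d) (N + Rr), x ^ j) = ω * ((x - 1) * ∑ j ∈ Icc (2 * Rr + d) (N + Rr), x ^ j) := by ring
      _ = ω * (x ^ (N + Rr + 1) - x ^ (2 * Rr + d)) := by rw [this]
  · rw [if_neg h, if_neg h, mul_zero, mul_zero]

/-- Slot bookkeeping: a vector with one live entry, read at slot `i`, as an indicator. [folklore] -/
theorem vec_single_ite (c : Prop) [Decidable c] (X : R) (i : Fin 3) :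
    ((if c then (![X, 0, 0] : Fin 3 → R) i else 0) = if i = 0 ∧ c then X else 0) ∧
    ((if c then (![0, X, 0] : Fin 3 → R) i else 0) = if i = 1 ∧ c then X else 0) ∧
    ((if c then (![0, 0, X] : Fin 3 → R) i else 0) = if i = 2 ∧ c then X else 0) := by
  fin_cases i <;> by_cases hc : c <;> simp [hc]

/-- Slot bookkeeping: the glue vector `(foot-bracketed, cross-bracketed, cross-bracketed)` read at slot `i`. [folklore] -/
theorem vec_bracket_ite (bf bc : Prop) [Decidable bf] [Decidable bc] (e : Fin 3 → R) (i : Fin 3) :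
    ((![if bf then e 0 else 0, if bc then e 1 else 0, if bc then e 2 else 0] : Fin 3 → R) i = if (i = 0 → bf) ∧ (i ≠ 0 → bc) then e i else 0) ∧
    ((![if bc then e 0 else 0, if bf then e 1 else 0, if bc then e 2 else 0] : Fin 3 → R) i = if (i = 1 → bf) ∧ (i ≠ 1 → bc) then e i else 0) ∧
    ((![if bc then e 0 else 0, if bc then e 1 else 0, if bf then e 2 else 0] : Fin 3 → R) i = if (i = 2 → bf) ∧ (i ≠ 2 → bc) then e i else 0) := by
  fin_cases i <;> by_cases hf : bf <;> by_cases hc : bc <;> simp [hf, hc]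

end Diag

end Summit.HodgeConjecture.HodgeConjecture.Cruxes.H413.F0P3cDyRamKappaCountBoxSumPlanes
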